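import Summits.BirchSwinnertonDyer.BirchSwinnertonDyer.Theorems.ManinLocalTwoThreeCubeStepPair
import Summits.BirchSwinnertonDyer.Rank1Residual.ManinAdditive.NineShiftFineReduction
import HarnessLib

/-!
# The cube step, III: E-es-103 `CubeStepDescent` and E-es-104 `CubeStepAntiDescent` by the transfer
# (route `ManinLocalTwoThree`, cell bsd-f2-manin; crux C3 `ManinPrimeToThreeAtNine` stmt-BirchSwinnertonDyer-22968; prover seat p3
# gen 10; closes es g23's cube-step nodes of `NineShiftFineReduction.lean`, MEMO-es §37.9 THEOREMS IV / IV⁻)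

Level `M` with `3 ∤ M`; `φ : Γ₀(3M) → 𝔽₃` additive with `φ(a, 3b; c, d) = ε φ(a, b; 3c, d)` (`ε = ±1`).  With the
pair `(coshift φ ε, restr φ)` of `…CubeStepPair.lean` and the section `sec` of the orbit map at `0 ∈ P¹(𝔽₃)`
(`sec [j:1] = T^j`, `sec ∞ = s := (δ, −1; M², 3)`, `3δ + M² = 1`), the TRANSFER `V g = Σₓ coshift φ ε (sec(g·x)⁻¹ g sec x)`
of the coshift character from the index-4 subgroup `stabZero = Stab(0)` is additive on `Γ₀(M)` and
* `V = restr φ` on `kerAct` (`4 ≡ 1 (mod 3)` and the conjugation invariance `restr_conj`);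
* `V(T) = 0`: the cocycle of `T` has the values `1, 1, T³, s⁻¹Ts = (1+3M², 9; −M⁴, 1−3M²)`, and the coshift kills
  `T³` (`φ(T) = 0`) and `s⁻¹Ts` (its coshift is `ε φ` of `(1+3M², 3; −3M⁴, 1−3M²)`, whose 3-shift partner
  `(1+3M², 1; −9M⁴, 1−3M²) = u⁻¹ T u`, `u = (1 0; 3M² 1) ∈ Γ₀(3M)`, is killed by `φ`);
* hence `V = restr φ` on `stabInf = kerAct·⟨T⟩ = Γ₀(3M)` and, conjugating by `s` (`s·0 = ∞`), `V = coshift φ ε` on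
  `stabZero`; so `w := V` is additive, restricts to `φ`, and is `ε`-(anti-)invariant under the 3-shift.
Main results: `cube_descent`, **`cubeStepDescent_holds : CubeStepDescent`** (E-es-103, THEOREM IV) and
**`cubeStepAntiDescent_holds : CubeStepAntiDescent`** (E-es-104, THEOREM IV⁻) — no Bass–Serre theory, no explicit
new pair, no presentation of `Γ₀(M)`.  Nothing about BSD or Manin's conjecture is asserted here.
-/

set_option autoImplicit false
set_option linter.dupNamespace false

open scoped MatrixGroups

open CongruenceSubgroup Matrix.SpecialLinearGroup
  Summit.BirchSwinnertonDyer.Rank1Residual.ManinAdditive.NineShiftEqualiser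

namespace Summit.BirchSwinnertonDyer.BirchSwinnertonDyer.Theorems.ManinLocalTwoThree

namespace CubeStep

open ThreeShiftDescent

/-! ### §1. The section of the orbit map at `0` and the transfer `V` -/

section TransferV

variable {M : ℕ}

/-- The action of `Γ₀(M)` on `P¹(𝔽₃)` through `SL(2, ℤ)`. [folklore] -/
def actG (γ : Gamma0 M) (ℓ : Option (ZMod 3)) : Option (ZMod 3) := act (γ : SL(2, ℤ)) ℓ

/-- `actG` is an action. [folklore] -/
theorem actG_mul (g h : Gamma0 M) (x : Option (ZMod 3)) : actG (g * h) x = actG g (actG h x) := act_mul _ _ _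

/-- `1` acts trivially. [folklore] -/
theorem actG_one (x : Option (ZMod 3)) : actG (1 : Gamma0 M) x = x := act_one x

/-- The Bezout element `s = (δ, −1; M², 3)` (`3δ + M² = 1`), which maps `0 ↦ ∞`. [folklore] -/
def sElt (M : ℕ) (δ : ℤ) (hδ : 3 * δ + (M : ℤ) * M = 1) : Gamma0 M :=
  g0Of δ (-1) ((M : ℤ) * M) 3 (by linear_combination hδ) (dvd_mul_right _ _)

/-- `s·0 = ∞`. [folklore] -/
theorem act_sElt_zero (δ : ℤ) (hδ : 3 * δ + (M : ℤ) * M = 1) : act (sElt M δ hδ : SL(2, ℤ)) (some 0) = none := by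
  rw [sElt, act_g0Of]
  simp only [vec, mul_zero, mul_one, zero_add, Int.cast_ofNat]
  decide

/-- `s⁻¹·∞ = 0`. [folklore] -/
theorem act_sElt_inv_none (δ : ℤ) (hδ : 3 * δ + (M : ℤ) * M = 1) :
    act ((sElt M δ hδ)⁻¹ : SL(2, ℤ)) none = some 0 := by
  conv_lhs => rw [← act_sElt_zero δ hδ]
  rw [act_inv_act]

/-- The section of the orbit map `g ↦ g·0`: `[j:1] ↦ T^j`, `∞ ↦ s`. [folklore] -/
def sec (M : ℕ) (δ : ℤ) (hδ : 3 * δ + (M : ℤ) * M = 1) : Option (ZMod 3) → Gamma0 M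
  | none => sElt M δ hδ
  | some j => Tpow M ((j.val : ℕ) : ℤ)

/-- `sec x · 0 = x`. [folklore] -/
theorem act_sec (δ : ℤ) (hδ : 3 * δ + (M : ℤ) * M = 1) (x : Option (ZMod 3)) :
    actG (sec M δ hδ x) (some 0) = x := by
  rcases x with _ | j
  · exact act_sElt_zero δ hδ
  · show act _ _ = _
    rw [sec, act_Tpow_some, zero_add, intCast_val]

variable (φ : Gamma0 (3 * M) → ZMod 3) (ε : ZMod 3) (δ : ℤ) (hδ : 3 * δ + (M : ℤ) * M = 1)

/-- **The transfer** of the coshift character from `stabZero = Stab(0)` to `Γ₀(M)`. [folklore] -/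
noncomputable def V (g : Gamma0 M) : ZMod 3 := transferSum actG (sec M δ hδ) (coshift φ ε) g

/-- `V` is additive on `Γ₀(M)`. [folklore] -/
theorem V_mul (hadd : IsAddChar φ) (g h : Gamma0 M) :
    V φ ε δ hδ (g * h) = V φ ε δ hδ g + V φ ε δ hδ h :=
  transferSum_mul actG (sec M δ hδ) actG_mul actG_one (act_sec δ hδ)
    (fun u v hu hv => coshift_add φ ε hadd u hu v hv) g h

/-- `(3 + 1) • r = r` in `ZMod 3`. [folklore] -/
theorem four_smul (r : ZMod 3) : (3 + 1) • r = r := by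
  revert r
  decide

/-- **`V = restr φ` on `kerAct`.** [folklore] -/
theorem V_of_mem_kerAct (hM3 : ¬ 3 ∣ M) (hadd : IsAddChar φ)
    (hinv : ∀ (a b c d : ℤ) (h : a * d - b * (3 * c) = 1) (hc : ((3 * M : ℕ) : ℤ) ∣ c),
      φ (g0Of a (3 * b) c d (by linear_combination h) hc) = ε * φ (g0Of a b (3 * c) d h (Dvd.dvd.mul_left hc 3)))
    {x : Gamma0 M} (hx : x ∈ kerAct M) : V φ ε δ hδ x = restr φ x := by
  have h : ∀ ℓ, coshift φ ε (tr actG (sec M δ hδ) x ℓ) = restr φ x := fun ℓ => by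
    have e : tr actG (sec M δ hδ) x ℓ = (sec M δ hδ ℓ)⁻¹ * x * sec M δ hδ ℓ := by
      unfold tr
      rw [show actG x ℓ = ℓ from hx ℓ]
    rw [e, coshift_eq_restr φ ε hM3 hinv _ (kerAct_inv_conj_mem _ hx)]
    simpa using restr_conj φ ε hM3 hadd hinv (sec M δ hδ ℓ)⁻¹ hx
  unfold V
  rw [transferSum_eq_card_smul actG (sec M δ hδ) h, Fintype.card_option, ZMod.card, four_smul]

/-- `φ(T) = 0` at level `3M` (the 3-shift of `T` is `T³`). [folklore] -/
theorem phi_Tpow_one (hadd : IsAddChar φ) (hε : ε * ε = 1)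
    (hinv : ∀ (a b c d : ℤ) (h : a * d - b * (3 * c) = 1) (hc : ((3 * M : ℕ) : ℤ) ∣ c),
      φ (g0Of a (3 * b) c d (by linear_combination h) hc) = ε * φ (g0Of a b (3 * c) d h (Dvd.dvd.mul_left hc 3))) :
    φ (Tpow (3 * M) 1) = 0 := by
  have h := hinv 1 1 0 1 (by ring) (dvd_zero _)
  have e3 : (g0Of 1 (3 * 1) 0 1 (by ring) (dvd_zero _) : Gamma0 (3 * M)) = Tpow (3 * M) 1 ^ (3 : ℕ) := by
    rw [pow_succ, pow_two, Tpow_mul_Tpow, Tpow_mul_Tpow]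
    exact g0Of_congr rfl (by ring) rfl rfl _ _ _ _
  have e1 : (g0Of 1 1 (3 * 0) 1 (by ring) (Dvd.dvd.mul_left (dvd_zero _) 3) : Gamma0 (3 * M)) = Tpow (3 * M) 1 :=
    g0Of_congr rfl rfl (by ring) rfl _ _ _ _
  rw [e3, e1, isAddChar_map_pow hadd] at h
  have h3 : (3 : ℕ) • φ (Tpow (3 * M) 1) = 0 := by
    rw [nsmul_eq_mul, show ((3 : ℕ) : ZMod 3) = 0 by decide, zero_mul]
  rw [h3] at h
  calc φ (Tpow (3 * M) 1) = ε * (ε * φ (Tpow (3 * M) 1)) := by rw [← mul_assoc, hε, one_mul]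
    _ = 0 := by rw [← h, mul_zero]

/-- `T^k = (T^1)^k` at any level. [folklore] -/
theorem Tpow_one_zpow_any (N : ℕ) (k : ℤ) : (Tpow N 1) ^ k = Tpow N k := by
  induction k using Int.induction_on with
  | zero => rw [zpow_zero, Tpow_zero]
  | succ n ih => rw [zpow_add_one, ih, Tpow_mul_Tpow]
  | pred n ih => rw [zpow_sub_one, ih, Tpow_inv, Tpow_mul_Tpow]; ring_nf

/-- `restr φ (T^k) = 0`. [folklore] -/
theorem restr_Tpow (hadd : IsAddChar φ) (hT : φ (Tpow (3 * M) 1) = 0) (k : ℤ) : restr φ (Tpow M k) = 0 := by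
  rw [Tpow, restr_g0Of φ 1 k 0 1 _ (dvd_zero _) (dvd_zero _), show (g0Of 1 k 0 1 _ _ : Gamma0 (3 * M)) =
    Tpow (3 * M) k from rfl, ← Tpow_one_zpow_any, addOn_map_zpow (H := ⊤) (fun x _ y _ => hadd x y)
    (Subgroup.mem_top _), hT, smul_zero]

/-- `coshift φ ε (T³) = ε φ(T) = 0`. [folklore] -/
theorem coshift_Tpow_three (hT : φ (Tpow (3 * M) 1) = 0) : coshift φ ε (Tpow M 3) = 0 := by
  rw [show (Tpow M 3 : Gamma0 M) = g0Of 1 (3 * 1) 0 1 (by ring) (dvd_zero _) from g0Of_congr rfl (by ring) rfl rfl _ _ _ _,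
    coshift_g0Of φ ε 1 1 0 1 _ _ (by ring) (dvd_zero _),
    show (g0Of 1 1 (3 * 0) 1 _ _ : Gamma0 (3 * M)) = Tpow (3 * M) 1 from g0Of_congr rfl rfl (by ring) rfl _ _ _ _, hT,
    mul_zero]

/-- The fixed-point value of the cocycle of `T`: `a₁ = s⁻¹ T s = (1 + 3M², 9; −M⁴, 1 − 3M²)`. [folklore] -/
def aElt (M : ℕ) : Gamma0 M :=
  g0Of (1 + 3 * ((M : ℤ) * M)) (3 * 3) (-((M : ℤ) * M * ((M : ℤ) * M))) (1 - 3 * ((M : ℤ) * M)) (by ring)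
    ⟨-((M : ℤ) * ((M : ℤ) * M)), by ring⟩

/-- `s a₁ = T s`. [folklore] -/
theorem sElt_mul_aElt : sElt M δ hδ * aElt M = Tpow M 1 * sElt M δ hδ := by
  unfold sElt aElt Tpow
  rw [g0Of_mul _ _ _ _ _ _ _ _ _ _ _ _ (det_mul_entries (by linear_combination hδ) (by ring))
      (dvd_add (Dvd.dvd.mul_right (dvd_mul_right _ _) _) (Dvd.dvd.mul_left ⟨-((M : ℤ) * ((M : ℤ) * M)), by ring⟩ _)),
    g0Of_mul _ _ _ _ _ _ _ _ _ _ _ _ (det_mul_entries (by ring) (by linear_combination hδ))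
      (dvd_add (Dvd.dvd.mul_right (dvd_zero _) _) (Dvd.dvd.mul_left (dvd_mul_right _ _) _))]
  exact g0Of_congr (by linear_combination ((M : ℤ) * M) * hδ) (by linear_combination 3 * hδ) (by ring) (by ring)
    _ _ _ _

/-- `s⁻¹ T s = a₁`. [folklore] -/
theorem sElt_inv_conj_T : (sElt M δ hδ)⁻¹ * Tpow M 1 * sElt M δ hδ = aElt M := by
  rw [mul_assoc, inv_mul_eq_iff_eq_mul, sElt_mul_aElt]

/-- **The coshift kills `a₁`**: its 3-shift partner chain ends at `u⁻¹ T u`, `u = (1 0; 3M² 1) ∈ Γ₀(3M)`. [folklore] -/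
theorem coshift_aElt (hadd : IsAddChar φ) (hT : φ (Tpow (3 * M) 1) = 0)
    (hinv : ∀ (a b c d : ℤ) (h : a * d - b * (3 * c) = 1) (hc : ((3 * M : ℕ) : ℤ) ∣ c),
      φ (g0Of a (3 * b) c d (by linear_combination h) hc) = ε * φ (g0Of a b (3 * c) d h (Dvd.dvd.mul_left hc 3))) :
    coshift φ ε (aElt M) = 0 := by
  have hc3 : ((3 * M : ℕ) : ℤ) ∣ 3 * -((M : ℤ) * M * ((M : ℤ) * M)) := ⟨-((M : ℤ) * M * M), by push_cast; ring⟩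
  rw [aElt, coshift_g0Of φ ε _ 3 _ _ _ _ (by ring) hc3]
  -- the partner `(1+3M², 3; −3M⁴, 1−3M²) = (a, 3·1; c, d)` with `3M ∣ c`: apply the invariance once more
  have hc3' : ((3 * M : ℕ) : ℤ) ∣ -((M : ℤ) * (M * (M * M))) * 3 := ⟨-((M : ℤ) * M * M), by push_cast; ring⟩
  have step : (g0Of (1 + 3 * ((M : ℤ) * M)) 3 (3 * -((M : ℤ) * M * ((M : ℤ) * M))) (1 - 3 * ((M : ℤ) * M))
      (by ring) hc3 : Gamma0 (3 * M)) =
      g0Of (1 + 3 * ((M : ℤ) * M)) (3 * 1) (-((M : ℤ) * (M * (M * M))) * 3) (1 - 3 * ((M : ℤ) * M))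
        (by ring) hc3' := g0Of_congr rfl (by ring) (by ring) rfl _ _ _ _
  rw [step, hinv _ 1 _ _ (by ring) hc3']
  -- `u * partner' = T * u` with `u = (1 0; 3M² 1) ∈ Γ₀(3M)`
  have hu3 : ((3 * M : ℕ) : ℤ) ∣ 3 * ((M : ℤ) * M) := ⟨(M : ℤ), by push_cast; ring⟩
  have key : (g0Of 1 0 (3 * ((M : ℤ) * M)) 1 (by ring) hu3 : Gamma0 (3 * M)) *
      g0Of (1 + 3 * ((M : ℤ) * M)) 1 (3 * (-((M : ℤ) * (M * (M * M))) * 3)) (1 - 3 * ((M : ℤ) * M))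
        (by ring) (Dvd.dvd.mul_left hc3' 3) =
      Tpow (3 * M) 1 * g0Of 1 0 (3 * ((M : ℤ) * M)) 1 (by ring) hu3 := by
    rw [Tpow, g0Of_mul _ _ _ _ _ _ _ _ _ _ _ _ (det_mul_entries (by ring) (by ring))
        (dvd_add (Dvd.dvd.mul_right hu3 _) (Dvd.dvd.mul_left (Dvd.dvd.mul_left hc3' 3) _)),
      g0Of_mul _ _ _ _ _ _ _ _ _ _ _ _ (det_mul_entries (by ring) (by ring))
        (dvd_add (Dvd.dvd.mul_right (dvd_zero _) _) (Dvd.dvd.mul_left hu3 _))]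
    exact g0Of_congr (by ring) (by ring) (by ring) (by ring) _ _ _ _
  have hP := eq_inv_mul_iff_mul_eq.mpr key
  have hinv1 : φ (g0Of 1 0 (3 * ((M : ℤ) * M)) 1 (by ring) hu3)⁻¹ + φ (g0Of 1 0 (3 * ((M : ℤ) * M)) 1 (by ring) hu3) =
      0 := by
    rw [← hadd, inv_mul_cancel, isAddChar_map_one hadd]
  rw [hP, hadd, hadd, hT, zero_add, hinv1, mul_zero, mul_zero]

/-- Values in `ZMod 3` used to evaluate the cocycle of `T`. [folklore] -/
theorem zmod3_vals : ((0 : ZMod 3) + 1).val = 1 ∧ ((1 : ZMod 3) + 1).val = 2 ∧ ((2 : ZMod 3) + 1).val = 0 ∧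
    (0 : ZMod 3).val = 0 ∧ (1 : ZMod 3).val = 1 ∧ (2 : ZMod 3).val = 2 := by
  decide

/-- The cocycle of `T` at a finite point `[j:1]`: `T^{−(j+1).val + 1 + j.val}`. [folklore] -/
theorem tr_T_some (j : ZMod 3) :
    tr actG (sec M δ hδ) (Tpow M 1) (some j) =
      Tpow M (-(((j + 1 : ZMod 3).val : ℕ) : ℤ) + 1 + ((j.val : ℕ) : ℤ)) := by
  unfold tr
  rw [show actG (Tpow M 1) (some j) = some (j + 1) by rw [actG, act_Tpow_some, Int.cast_one]]
  simp only [sec]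
  rw [Tpow_inv, Tpow_mul_Tpow, Tpow_mul_Tpow]

/-- The cocycle of `T` at `∞`: `s⁻¹ T s = a₁`. [folklore] -/
theorem tr_T_none : tr actG (sec M δ hδ) (Tpow M 1) none = aElt M := by
  unfold tr
  rw [show actG (Tpow M 1) none = none from act_Tpow_none 1]
  exact sElt_inv_conj_T δ hδ

/-- The cocycle of `T` at `[0:1]` is `1`. [folklore] -/
theorem tr_T_zero : tr actG (sec M δ hδ) (Tpow M 1) (some 0) = 1 := by
  rw [tr_T_some, zmod3_vals.1, zmod3_vals.2.2.2.1]
  norm_num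
  exact Tpow_zero

/-- The cocycle of `T` at `[1:1]` is `1`. [folklore] -/
theorem tr_T_one : tr actG (sec M δ hδ) (Tpow M 1) (some 1) = 1 := by
  rw [tr_T_some, zmod3_vals.2.1, zmod3_vals.2.2.2.2.1]
  norm_num
  exact Tpow_zero

/-- The cocycle of `T` at `[2:1]` is `T³`. [folklore] -/
theorem tr_T_two : tr actG (sec M δ hδ) (Tpow M 1) (some 2) = Tpow M 3 := by
  rw [tr_T_some, zmod3_vals.2.2.1, zmod3_vals.2.2.2.2.2]
  norm_num

/-- A sum over `ZMod 3`. [folklore] -/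
theorem sum_zmod3 (f : ZMod 3 → ZMod 3) : ∑ j, f j = f 0 + f 1 + f 2 := Fin.sum_univ_three f

/-- **`V(T) = 0`.** [folklore] -/
theorem V_Tpow_one (hadd : IsAddChar φ) (hT : φ (Tpow (3 * M) 1) = 0)
    (hinv : ∀ (a b c d : ℤ) (h : a * d - b * (3 * c) = 1) (hc : ((3 * M : ℕ) : ℤ) ∣ c),
      φ (g0Of a (3 * b) c d (by linear_combination h) hc) = ε * φ (g0Of a b (3 * c) d h (Dvd.dvd.mul_left hc 3))) :
    V φ ε δ hδ (Tpow M 1) = 0 := by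
  have h0 : coshift φ ε (1 : Gamma0 M) = 0 := addOn_map_one (coshift_add φ ε hadd)
  unfold V transferSum
  rw [Fintype.sum_option, sum_zmod3, tr_T_none, tr_T_zero, tr_T_one, tr_T_two, coshift_aElt φ ε hadd hT hinv, h0,
    coshift_Tpow_three φ ε hT]
  norm_num

/-- `V(T^k) = 0`. [folklore] -/
theorem V_Tpow (hadd : IsAddChar φ) (hT : φ (Tpow (3 * M) 1) = 0)
    (hinv : ∀ (a b c d : ℤ) (h : a * d - b * (3 * c) = 1) (hc : ((3 * M : ℕ) : ℤ) ∣ c),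
      φ (g0Of a (3 * b) c d (by linear_combination h) hc) = ε * φ (g0Of a b (3 * c) d h (Dvd.dvd.mul_left hc 3)))
    (k : ℤ) : V φ ε δ hδ (Tpow M k) = 0 := by
  rw [← Tpow_one_zpow_any, addOn_map_zpow (H := ⊤) (fun x _ y _ => V_mul φ ε δ hδ hadd x y) (Subgroup.mem_top _),
    V_Tpow_one φ ε δ hδ hadd hT hinv, smul_zero]

/-- **`V = restr φ` on `stabInf = Γ₀(3M)`.** [folklore] -/
theorem V_of_mem_stabInf (hM3 : ¬ 3 ∣ M) (hadd : IsAddChar φ) (hT : φ (Tpow (3 * M) 1) = 0)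
    (hinv : ∀ (a b c d : ℤ) (h : a * d - b * (3 * c) = 1) (hc : ((3 * M : ℕ) : ℤ) ∣ c),
      φ (g0Of a (3 * b) c d (by linear_combination h) hc) = ε * φ (g0Of a b (3 * c) d h (Dvd.dvd.mul_left hc 3)))
    {b : Gamma0 M} (hb : b ∈ stabInf M) : V φ ε δ hδ b = restr φ b := by
  obtain ⟨k, c, hc, rfl⟩ := exists_kerAct_mul_Tpow hb
  rw [V_mul φ ε δ hδ hadd, V_of_mem_kerAct φ ε δ hδ hM3 hadd hinv hc, V_Tpow φ ε δ hδ hadd hT hinv,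
    restr_add φ hM3 hadd c (stabInf_of_kerAct hc) _ (Tpow_mem_stabInf k), restr_Tpow φ hadd hT]

/-- `a₁ ∈ stabZero`. [folklore] -/
theorem aElt_mem_stabZero : aElt M ∈ stabZero M := by
  unfold aElt
  exact g0Of_mem_stabZero _ 3 _ _ _ _

/-- **`V = coshift φ ε` on `stabZero`** (conjugate into `stabInf` by `s`). [folklore] -/
theorem V_of_mem_stabZero (hM3 : ¬ 3 ∣ M) (hadd : IsAddChar φ) (hT : φ (Tpow (3 * M) 1) = 0)
    (hinv : ∀ (a b c d : ℤ) (h : a * d - b * (3 * c) = 1) (hc : ((3 * M : ℕ) : ℤ) ∣ c),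
      φ (g0Of a (3 * b) c d (by linear_combination h) hc) = ε * φ (g0Of a b (3 * c) d h (Dvd.dvd.mul_left hc 3)))
    {a : Gamma0 M} (ha : a ∈ stabZero M) : V φ ε δ hδ a = coshift φ ε a := by
  have hb : sElt M δ hδ * a * (sElt M δ hδ)⁻¹ ∈ stabInf M := by
    rw [mem_stabInf, Subgroup.coe_mul, Subgroup.coe_mul, act_mul, act_mul, Subgroup.coe_inv,
      act_sElt_inv_none δ hδ, mem_stabZero.mp ha, act_sElt_zero δ hδ]
  obtain ⟨k, c, hc, hdec⟩ := exists_kerAct_mul_Tpow hb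
  have hcs : (sElt M δ hδ)⁻¹ * c * sElt M δ hδ ∈ kerAct M := kerAct_inv_conj_mem _ hc
  -- `s⁻¹ T^k s = a₁^k` and `a = (s⁻¹ c s) · a₁^k`
  have hpow : (sElt M δ hδ)⁻¹ * Tpow M k * sElt M δ hδ = aElt M ^ k := by
    rw [← sElt_inv_conj_T δ hδ, ← Tpow_one_zpow_any]
    have h := (conj_zpow (a := (sElt M δ hδ)⁻¹) (b := Tpow M 1) (i := k)).symm
    rwa [inv_inv] at h
  have ha' : a = ((sElt M δ hδ)⁻¹ * c * sElt M δ hδ) * aElt M ^ k := by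
    have e : a = (sElt M δ hδ)⁻¹ * (sElt M δ hδ * a * (sElt M δ hδ)⁻¹) * sElt M δ hδ := by group
    rw [e, hdec, ← hpow]
    group
  -- the value of `V`
  have hVconj : V φ ε δ hδ (sElt M δ hδ * a * (sElt M δ hδ)⁻¹) = V φ ε δ hδ a := by
    rw [V_mul φ ε δ hδ hadd, V_mul φ ε δ hδ hadd,
      addOn_map_inv (H := ⊤) (fun x _ y _ => V_mul φ ε δ hδ hadd x y) (Subgroup.mem_top _)]
    abel
  have hV : V φ ε δ hδ a = restr φ c := by
    rw [← hVconj, V_of_mem_stabInf φ ε δ hδ hM3 hadd hT hinv hb, hdec,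
      restr_add φ hM3 hadd c (stabInf_of_kerAct hc) _ (Tpow_mem_stabInf k), restr_Tpow φ hadd hT, add_zero]
  -- the value of `coshift`
  have hC : coshift φ ε a = restr φ c := by
    rw [ha', coshift_add φ ε hadd _ (stabZero_of_kerAct hcs) _ ((stabZero M).zpow_mem aElt_mem_stabZero k),
      addOn_map_zpow (coshift_add φ ε hadd) aElt_mem_stabZero k, coshift_aElt φ ε hadd hT hinv, smul_zero,
      add_zero, coshift_eq_restr φ ε hM3 hinv _ hcs]
    simpa using restr_conj φ ε hM3 hadd hinv (sElt M δ hδ)⁻¹ hc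
  rw [hV, hC]

end TransferV

/-! ### §2. The cube step: E-es-103 and E-es-104 -/

section Main

variable {M : ℕ}

/-- **THE CUBE STEP, uniform in `ε = ±1`.**  For `3 ∤ M` and `φ : Γ₀(3M) → 𝔽₃` additive with
`φ(a, 3b; c, d) = ε φ(a, b; 3c, d)` (`3M ∣ c`), the transfer `w = V` is additive on `Γ₀(M)`, satisfies
`w(a, 3b; c, d) = ε w(a, b; 3c, d)` (`M ∣ c`), and restricts to `φ`. [new: transfer proof of MEMO-es §37.9 THMS IV/IV⁻] -/
theorem cube_descent (hM3 : ¬ 3 ∣ M) (φ : Gamma0 (3 * M) → ZMod 3) (ε : ZMod 3) (hε : ε * ε = 1)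
    (hadd : IsAddChar φ)
    (hinv : ∀ (a b c d : ℤ) (h : a * d - b * (3 * c) = 1) (hc : ((3 * M : ℕ) : ℤ) ∣ c),
      φ (g0Of a (3 * b) c d (by linear_combination h) hc) = ε * φ (g0Of a b (3 * c) d h (Dvd.dvd.mul_left hc 3))) :
    ∃ w : Gamma0 M → ZMod 3, IsAddChar w ∧
      (∀ (a b c d : ℤ) (hdet : a * d - b * (3 * c) = 1) (hc : (M : ℤ) ∣ c),
        w (g0Of a (3 * b) c d (by linear_combination hdet) hc) = ε * w (g0Of a b (3 * c) d hdet (Dvd.dvd.mul_left hc 3))) ∧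
      RestrictsFrom φ w := by
  obtain ⟨δ, hδ⟩ := exists_delta hM3
  have hT := phi_Tpow_one φ ε hadd hε hinv
  refine ⟨V φ ε δ hδ, fun g h => V_mul φ ε δ hδ hadd g h, ?_, ?_⟩
  · intro a b c d hdet hc
    rw [V_of_mem_stabZero φ ε δ hδ hM3 hadd hT hinv (g0Of_mem_stabZero a b c d (by linear_combination hdet) hc),
      coshift_g0Of φ ε a b c d _ hc hdet (dvd_three_mul' hc),
      V_of_mem_stabInf φ ε δ hδ hM3 hadd hT hinv (g0Of_mem_stabInf hM3 a b (3 * c) d hdet _ (dvd_three_mul' hc)),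
      restr_g0Of φ a b (3 * c) d hdet _ (dvd_three_mul' hc)]
  · intro a b c d hdet hcN hcM
    rw [V_of_mem_stabInf φ ε δ hδ hM3 hadd hT hinv (g0Of_mem_stabInf hM3 a b c d hdet hcM hcN),
      restr_g0Of φ a b c d hdet hcM hcN]

/-- **E-es-103 `CubeStepDescent` (THEOREM IV of MEMO-es §37.9): `K₃(3M) = res K₃(M)` for `3 ∤ M`.**
[new: transfer proof; es g23 THEOREM IV on paper via Bass–Serre] -/
theorem cubeStepDescent_holds : CubeStepDescent := by
  intro M N _ hM3 hN φ hadd hinv3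
  subst hN
  obtain ⟨w, hw, hwinv, hres⟩ := cube_descent hM3 φ 1 (by norm_num) hadd
    (fun a b c d h hc => by rw [one_mul]; exact hinv3 a b c d h hc)
  exact ⟨w, hw, fun a b c d h hc => by rw [hwinv, one_mul], hres⟩

/-- **E-es-104 `CubeStepAntiDescent` (THEOREM IV⁻ of MEMO-es §37.9): `K₃⁻(3M) ⊆ res K₃⁻(M)` for `3 ∤ M`.**
[new: transfer proof; es g23 THEOREM IV⁻ on paper via Bass–Serre] -/
theorem cubeStepAntiDescent_holds : CubeStepAntiDescent := by
  intro M N _ hM3 hN ψ hadd hinv3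
  subst hN
  obtain ⟨w, hw, hwinv, hres⟩ := cube_descent hM3 ψ (-1) (by norm_num) hadd
    (fun a b c d h hc => by rw [neg_one_mul]; exact hinv3 a b c d h hc)
  exact ⟨w, hw, fun a b c d h hc => by rw [hwinv, neg_one_mul], hres⟩

end Main


end CubeStep

end Summit.BirchSwinnertonDyer.BirchSwinnertonDyer.Theorems.ManinLocalTwoThree
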